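import Summits.Ventures.PercRepro.C041CycleMarksCone

/-!
# THE TRIANGLE WITH `p` MARKS OF TYPE 1 AT ONE EXIT AND `p` OF TYPE 2 AT THE OTHER IS IN THE CONE, FOR EVERY `p`
(mine-3, gen 59; C-041.md §21 (d), (ac))

The first infinite family of the cone form with valid type states: for `X(p, 0) = v 1 ^ p = (1, 2^p, 1, 0, 1, 0)` and
`X(0, p) = v 0 ^ p`, writing `A = 2^p`,
  `θ_△(X(p,0), X(0,p)) = 3·1 + (2 + 3A/2)·(v 1 + v 0) + A²·X(1,1) + (A/2 − 2)·(X(2,0) + X(0,2))`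
— an identity of six-vectors polynomial in `A` (`thetaTri_pow_one_pow_zero`; found by the lane's exact LP at `p = 2 … 6`
on symmetric marks-only generators and read off: coefficients `8, 14, 26, 50, 98 = 2 + 3·2^{p−1}` and `0, 2, 6, 14, 30 =
2^{p−1} − 2`).  For `p ≥ 2` every coefficient is non-negative, so the triangle lies in the cone
(`InCone_thetaTri_pow_one_pow_zero`); `p = 1` is the `α = β` case; hence every two-exit cycle carrying `p` marks of type 1
at one vertex and `p` of type 2 at the other lies in the cone (`InCone_thetaCyc_pow_one_pow_zero`).  The mixed-type defect
here is `α = (2^p − 1)² ≠ β = 1` for `p ≥ 2` — the «first hard instance» of C-041.md §21 (f).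
-/

namespace PercRepro

namespace RelaxedTriangle

open TreeClosure

/-- The coordinates of `v 1 ^ p`: `(1, 2^p, 1, 0, 1, 0)` for `p ≥ 1`. -/
theorem pow_v_one_eq (p : ℕ) (hp : 1 ≤ p) :
    v 1 ^ p = ![1, (2 : ℝ) ^ p, 1, 0, 1, 0] := by
  have hp0 : p ≠ 0 := by omega
  ext i
  simp only [Pi.pow_apply, v]
  fin_cases i <;> simp [zero_pow hp0]
  norm_num

/-- The coordinates of `v 0 ^ p`: `(1, 1, 2^p, 0, 0, 1)` for `p ≥ 1`. -/
theorem pow_v_zero_eq (p : ℕ) (hp : 1 ≤ p) :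
    v 0 ^ p = ![1, 1, (2 : ℝ) ^ p, 0, 0, 1] := by
  have hp0 : p ≠ 0 := by omega
  ext i
  simp only [Pi.pow_apply, v]
  fin_cases i <;> simp [zero_pow hp0]
  norm_num

/-- **THE FAMILY IDENTITY**: `θ_△(X(p,0), X(0,p)) = 3·1 + (2 + 3·2^p/2)·(v 1 + v 0) + (2^p)²·X(1,1) + (2^p/2 − 2)·(X(2,0) + X(0,2))`
for every `p ≥ 1`. -/
theorem thetaTri_pow_one_pow_zero (p : ℕ) (hp : 1 ≤ p) :
    thetaTri (v 1 ^ p) (v 0 ^ p) = (3 : ℝ) • (1 : Vec6) + (2 + 3 * (2 : ℝ) ^ p / 2) • (v 1 + v 0)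
      + ((2 : ℝ) ^ p) ^ 2 • (v 1 * v 0) + ((2 : ℝ) ^ p / 2 - 2) • (v 1 * v 1 + v 0 * v 0) := by
  rw [pow_v_one_eq p hp, pow_v_zero_eq p hp]
  ext i
  simp only [thetaTri_eq_vec, Pi.add_apply, Pi.smul_apply, Pi.mul_apply, Pi.one_apply, smul_eq_mul, v]
  fin_cases i <;> simp <;> ring

/-- `2^p ≥ 4` for `p ≥ 2`. -/
theorem four_le_two_pow (p : ℕ) (hp : 2 ≤ p) : (4 : ℝ) ≤ 2 ^ p := by
  have : (2 : ℝ) ^ 2 ≤ 2 ^ p := pow_le_pow_right₀ (by norm_num) hp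
  linarith

/-- **THEOREM (TRIANGLE, `p` marks of each type at opposite exits)**: for `p ≥ 2` the triangle with `X(p, 0)` and `X(0, p)`
at its exits lies in the cone. -/
theorem InCone_thetaTri_pow_one_pow_zero (p : ℕ) (hp : 2 ≤ p) : InCone (thetaTri (v 1 ^ p) (v 0 ^ p)) := by
  rw [thetaTri_pow_one_pow_zero p (by omega)]
  have h4 := four_le_two_pow p hp
  have hA : (0 : ℝ) ≤ 2 ^ p := by positivity
  refine (((InCone.smul 3 (by norm_num) InCone_one).add
    (InCone.smul _ (by positivity) (InCone_v1.add InCone_v0))).add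
    (InCone.smul _ (by positivity) InCone_X11)).add
    (InCone.smul _ (by linarith) ((InCone_v1.mul InCone_v1).add (InCone_v0.mul InCone_v0)))

/-- The same for every `p ≥ 1` (`p = 1` by the vanishing mixed-type defect). -/
theorem InCone_thetaTri_pow_one_pow_zero' (p : ℕ) (hp : 1 ≤ p) : InCone (thetaTri (v 1 ^ p) (v 0 ^ p)) := by
  rcases Nat.lt_or_ge p 2 with h | h
  · have h1 : p = 1 := by omega
    subst h1
    simp only [pow_one]
    exact thetaTri_InCone_of_alpha_eq_beta InCone_v1 InCone_v0 (by simp [T1, T2, I1, I2, v])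
  · exact InCone_thetaTri_pow_one_pow_zero p h

/-- **Every two-exit cycle with `p` marks of type 1 at one vertex and `p` of type 2 at the other lies in the cone**
(`p ≥ 1`, any multiplicities). -/
theorem InCone_thetaCyc_pow_one_pow_zero (p₀ : ℕ) (hp₀ : 1 ≤ p₀) {p q s : ℝ} (hp : 0 ≤ p) (hq : 0 ≤ q)
    (hs : 0 ≤ s) : InCone (thetaCyc p q s (v 1 ^ p₀) (v 0 ^ p₀)) :=
  InCone_thetaCyc_of_InCone_tri (InCone_pow_v_one p₀) (InCone_pow_v_zero p₀)
    (InCone_thetaTri_pow_one_pow_zero' p₀ hp₀) hp hq hs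

end RelaxedTriangle

end PercRepro
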